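import Summits.Ventures.HodgeRepro.Night3GSetFormHodgeType
import Summits.Ventures.HodgeRepro.Night3GSetNight1Bridge

/-!
# The Hodge type of `y ∧ Λ` for a Weil class `y` of a zero-sum family

Blind re-derivation cell `pub-hodge-repro`, seat `night-3` (gen 6, row B; NIGHT3.md §13.4).  Imports gen 5's
`Night3GSetFormHodgeType` (the eigen predicate `IsEigen Ψ p x` on the exterior algebra, `IsEigen.mul`, Weil's class
`Λc` is a `((m−1)n, (m−1)n)`-class, the bridge `mem_jointEigenspaceOn_of_isEigen`) and gen 4's
`Night3GSetNight1Bridge` (for a zero-sum family `T` of `2k` CM types the concrete Weil space is a space of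
`(k, k)`-classes: `weilSpace_familyMul_le_jointEigenspaceOn`).  Namespace `HodgeRepro.Night3.GSetModel`.

* `isEigen_of_mem_jointEigenspaceOn`: the converse bridge — a member of typer-2's `jointEigenspaceOn Ψ d p` is
  `IsEigen Ψ p` as an element of the algebra;
* `mul_mem_exteriorPower`: the graded product `⋀^d · ⋀^e ⊆ ⋀^{d+e}`;
* `isEigen_castH_of_mem_weilSpace`: for a zero-sum family every Weil class is a `(k, k)`-class (transported by the
  cast `|familyMul T| = 2k`);
* **`isEigen_mul_Λc_of_mem_weilSpace`** / **`mul_Λc_mem_jointEigenspaceOn`**: for a Weil class `y` of a zero-sum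
  family and Weil's class `Λ = ∏_i L_i^{m−1}`, the product `y ∧ Λ` is a Hodge class of type
  `(k + (m−1)·2k, k + (m−1)·2k)` in degree `2k + 2(m−1)·2k` for every Galois-conjugate cocharacter of the corner
  product — the correspondence class `pr_N^*(y ∪ Λ_N)` of Lemma P step (2) is a Hodge class.

READING: the algebraicity of `y ∪ Λ` is the hypothesis HprojGeom / (K2) of the lineage (with `y` algebraic by the
induction and `Λ` by Lefschetz (1,1) on the `L_i`); its Hodge type is what is checked here.  `Alg` is not mentioned;
nothing here closes S4; nothing here says anything about the status of the Hodge conjecture for CM abelian varieties,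
which is NOT proved.
-/

set_option autoImplicit false
open Finset Module
open scoped Pointwise
namespace HodgeRepro.Night3.GSetModel

open HodgeRepro.CMHodgeOn HodgeRepro.Night3.GSet ExteriorAlgebra

/-! ### The converse bridge and the graded product -/

section Bridge

variable {X : Type*} [DecidableEq X] {Γ : Type*}

/-- A member of typer-2's `jointEigenspaceOn Ψ d p` is a `(p, p)`-class in the algebra sense. -/
theorem isEigen_of_mem_jointEigenspaceOn (Ψ : Γ → Finset X) {d p : ℕ} {x : ⋀[ℂ]^d (X → ℂ)}
    (hx : x ∈ jointEigenspaceOn Ψ d p) : IsEigen Ψ p (x : ExteriorAlgebra ℂ (X → ℂ)) := by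
  rw [mem_jointEigenspaceOn_iff] at hx
  intro γ lam
  have h := congrArg Subtype.val (hx γ lam)
  rwa [coe_exteriorPower_map, Submodule.coe_smul] at h

end Bridge

section Product

variable {R : Type*} [CommRing R] {M : Type*} [AddCommGroup M] [Module R M]

/-- The graded product: `x ∈ ⋀^d`, `z ∈ ⋀^e` give `x * z ∈ ⋀^{d+e}`. -/
theorem mul_mem_exteriorPower {d e : ℕ} {x z : ExteriorAlgebra R M} (hx : x ∈ ⋀[R]^d M) (hz : z ∈ ⋀[R]^e M) :
    x * z ∈ ⋀[R]^(d + e) M := by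
  rw [exteriorPower, pow_add]
  exact Submodule.mul_mem_mul hx hz

end Product

/-! ### Weil classes of a zero-sum family times `Λ` -/

section LambdaType

variable {G : Type*} [Group G] [Fintype G] [DecidableEq G] [LinearOrder G]

omit [LinearOrder G] in
/-- For a zero-sum family `T` of `2k` CM types, every Weil class (transported to `Hn G (2k)` by the cast) is a
`(k, k)`-class for the Galois-conjugate cocharacters of the corner product. -/
theorem isEigen_castH_of_mem_weilSpace {c : G} (hc : IsComplexConj c) {k : ℕ} {T : Fin (2 * k) → Finset G}
    (hT : ∀ i, IsCMType c (T i)) (hM : IsZeroSumG c (familyMul T)) {y : H (familyMul T)}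
    (hy : y ∈ weilSpace (familyMul T)) :
    IsEigen (fun g : G => prodTypeSet fun i => g • T i) k
      (castH (G := G) (card_familyMul T) y : ExteriorAlgebra ℂ (V G (2 * k))) :=
  isEigen_of_mem_jointEigenspaceOn _ (weilSpace_familyMul_le_jointEigenspaceOn hc hT hM
    (Submodule.mem_map_of_mem (f := (castH (G := G) (card_familyMul T)).toLinearMap) hy))

omit [LinearOrder G] in
/-- **`y ∧ Λ` is a `(k + (m−1)·2k, k + (m−1)·2k)`-class** for a Weil class `y` of a zero-sum family of `2k` CM
types and Weil's class `Λ = ∏_i L_i^{m−1}` (`m = |Φ₀|`). -/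
theorem isEigen_mul_Λc_of_mem_weilSpace {c : G} (hc : IsComplexConj c) {Φ₀ : Finset G} {k : ℕ}
    {T : Fin (2 * k) → Finset G} (hT : ∀ i, IsCMType c (T i)) (hM : IsZeroSumG c (familyMul T))
    (a : Fin (2 * k) → G → ℂ) {y : H (familyMul T)} (hy : y ∈ weilSpace (familyMul T)) :
    IsEigen (fun g : G => prodTypeSet fun i => g • T i) (k + (Φ₀.card - 1) * (2 * k))
      ((castH (G := G) (card_familyMul T) y : ExteriorAlgebra ℂ (V G (2 * k))) * Λc c Φ₀ a) :=
  (isEigen_castH_of_mem_weilSpace hc hT hM hy).mul (isEigen_Λc hc T hT a)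

omit [LinearOrder G] in
/-- **The correspondence class `y ∧ Λ` is a Hodge class**: for a Weil class `y` of a zero-sum family of `2k` CM types,
`y ∧ Λ ∈ jointEigenspaceOn Ψ (2k + 2(m−1)·2k) (k + (m−1)·2k)` for the Galois-conjugate cocharacters `Ψ` of the
corner product. -/
theorem mul_Λc_mem_jointEigenspaceOn {c : G} (hc : IsComplexConj c) {Φ₀ : Finset G} {k : ℕ}
    {T : Fin (2 * k) → Finset G} (hT : ∀ i, IsCMType c (T i)) (hM : IsZeroSumG c (familyMul T))
    (a : Fin (2 * k) → G → ℂ) {y : H (familyMul T)} (hy : y ∈ weilSpace (familyMul T)) :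
    (⟨(castH (G := G) (card_familyMul T) y : ExteriorAlgebra ℂ (V G (2 * k))) * Λc c Φ₀ a,
        mul_mem_exteriorPower (castH (G := G) (card_familyMul T) y).2 (coe_Λc_mem c Φ₀ a)⟩ :
      ⋀[ℂ]^(2 * k + 2 * (Φ₀.card - 1) * (2 * k)) (V G (2 * k))) ∈
      jointEigenspaceOn (fun g : G => prodTypeSet fun i => g • T i) (2 * k + 2 * (Φ₀.card - 1) * (2 * k))
        (k + (Φ₀.card - 1) * (2 * k)) :=
  mem_jointEigenspaceOn_of_isEigen _ _ (isEigen_mul_Λc_of_mem_weilSpace hc hT hM a hy)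

end LambdaType

end HodgeRepro.Night3.GSetModel
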